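import Literature.AlgebraicGeometry.Resolution.KawasakiLocalAnalysis
import Literature.AlgebraicGeometry.Resolution.KawasakiBlowupStalks
import Literature.AlgebraicGeometry.Resolution.KawasakiCentreSheaf
import HarnessLib

/-!
# Kawasaki's pointwise verification at a closed point (Kawasaki 2000, proof of Thm. 5.1, p. 2539)

Topic: `Literature/AlgebraicGeometry/Resolution` — the global step of Kawasaki's Macaulayfication
(Kawasaki 2000, §5), piece W3 "pointwise verification" of the discharge of the named fact
`KawasakiMacaulayfication` (`Macaulayfication.lean`). Kawasaki, p. 2539: having chosen forms
`z_1, …, z_d` with `z_i ∈ 𝔞(R/(z_{i+1}, …, z_d)R)` (La. 5.3) and blown up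
`𝔟 = ∏_i (z_i, …, z_d)`, *"Let `q` be a closed point on `Y` and `𝔭` its image under `f`. If
`𝔟 ⊄ 𝔭`, then `∏ ann Hʲ(D) ⊄ 𝔭`. Hence `𝒪_{Y,q} = R_(𝔭)` is Cohen–Macaulay. Assume that `𝔟 ⊆ 𝔭`.
Then `z_t, …, z_d ∈ 𝔭` and `z_{t-1} ∉ 𝔭` for some `t` … (1) `dim R_(𝔭)/(x_t, …, x_d)R_(𝔭) =
dim R_(𝔭) - (d - t + 1)`; (2), (3) `x_i ∈ 𝔞(R_(𝔭)/(x_{i+1}, …, x_d)R_(𝔭))`; (4)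
`𝔞(R_(𝔭)/(x_t, …, x_d)R_(𝔭)) = R_(𝔭)` if `t > 1`. Hence `x_t, …, x_d` is a subsystem of a
p-standard system of parameters for `R_(𝔭)` and `R_(𝔭)/(x_t, …, x_d)R_(𝔭)` is a Cohen–Macaulay
ring if `t > 1`. Since `𝔟R_(𝔭) = ∏_{i ≥ t} (x_i, …, x_d)R_(𝔭)`, Corollary 4.2 says that `𝒪_{Y,q}`
is Cohen–Macaulay."*

This file assembles exactly this paragraph from the tree's local analysis
(`KawasakiLocalAnalysis.lean`, items 1–4 over a surjection `S ↠ O` from a regular local ring, and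
the bridge `mem_secantColonAnnihilator_of_mem_extAnn` from a GLOBAL `Ext`-annihilator membership on
a chart to `𝔯_S` of the local module) and the blow-up theorem
`IsBlowup.cmClause_stalk_of_kawasakiCenter` (`KawasakiBlowupStalks.lean`, Kawasaki's Cor. 4.2),
HYPOTHESES-STYLE: the chart dictionary (the local ring `𝒪_{X,p}` and its quotients as base
changes of the chart modules to `S = 𝒪_{ℙⁿ,p}`) and the choice of the forms enter as named
hypotheses, so that the sibling files (homogeneous annihilator ideal, selection of the forms, chart
base change) plug in by `exact`.

* `mem_secantColonAnnihilator_quotient_of_mem_extAnn` — the bridge for a quotient `O ⧸ J` at the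
  GLOBAL window `(n - e, max n 2]`, `dim O ⧸ J ≤ e` (window shift `extAnn_Ioc_mono`: a module of
  smaller dimension has fewer factors in its `Ext`-annihilator product);
* `kawasaki_pointwise_package` — **items 1, 2, 4**: for chart representatives `g_0, …, g_{d-1} ∈ B`
  (Kawasaki's order) and a cut `t` (`g_t, …, g_{d-1}` vanish at `p`, `g_{t-1}` is a unit at `p`),
  the memberships `g_l ∈ extAnn B M_{l+1} (n - (l+1), max n 2]` and the bounds
  `dim O/(g_l, …, g_{d-1}) ≤ l` give: the images `x_t, …, x_{d-1}` are a `p`-standard sequence of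
  `O`, with a tail `Z ⊆ 𝔪_O` weakly regular on `O/(x)`, `x, Z` secant, `dim O ≤ |x| + |Z|` —
  literally the hypotheses of `IsBlowup.cmClause_stalk_of_kawasakiCenter` (the reverse dimension
  inequality is Krull's bound `supportDim_le_supportDim_quotient_add_length`, so no
  equidimensionality statement is needed here);
* `cmClause_of_mem_extAnn_of_isUnit` — **item 3**: if the representative of the last form is a unit
  at `p` then `O` itself is Cohen–Macaulay;
* `kawasakiCenter_append_of_isUnit_getLast`, `kawasakiCenter_ofFn_eq_drop_of_isUnit` — the sharp
  local form of the centre: `𝔟(z_0, …, z_{d-1}) 𝒪_p = 𝔟(z_t, …, z_{d-1}) 𝒪_p` as soon as the LAST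
  prefix entry `z_{t-1}` is a unit (the tree's `kawasakiCenter_append_of_isUnit` asks all prefix
  entries to be units; `z_0, …, z_{t-2}` may vanish at `p`);
* `IsBlowup.cmClause_stalk_of_kawasakiCentreSheaf` — **the scheme statement**: for `r : Y → ℙⁿ_k`
  affine, `Y` integral locally Noetherian, `π : X' → Y` a blowing up along
  `kawasakiCentreSheaf r z N hz` and `x' ∈ X'` over `p ∈ r⁻¹D₊(x_j)`, the package at `𝒪_{Y,p}`
  (with `g_l` mapping to the germs of the chart values `z_l/x_j^{N_l}`) makes every system of
  parameters of `𝒪_{X',x'}` a weakly regular sequence (`stalkIdeal_kawasakiCentreSheaf` +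
  the sharp local form + Cor. 4.2).

Everything is proved; no named facts; no definitions. Indexing: forms `z_0, …, z_{d-1}` in
KAWASAKI's order (`z_l ∈ 𝔞` over `(z_{l+1}, …, z_{d-1})`, support of the centre `V₊(z_{d-1})`,
the currency of `kawasakiCentreSheaf`); Kawasaki's selection order `r_i = z_{d-i}` appears only
inside the proof of `kawasaki_pointwise_package` when feeding
`isPStandard_reverse_map_of_mem_secantColonAnnihilator`.

## References

* T. Kawasaki, *On Macaulayfication of Noetherian schemes*, Trans. Amer. Math. Soc. 352 (2000)
  2517–2552: proof of Thm. 5.1 (p. 2539, items 1–4), La. 5.3, Cor. 4.2. [Kawasaki2000]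
* K. Česnavičius, *Macaulayfication of Noetherian schemes*, Duke Math. J. 170 (2021), Thm. 3.13,
  §5. [Cesnavicius2021]
-/

noncomputable section

open IsLocalRing Ideal RingTheory.Sequence Module

universe u

namespace Literature.AlgebraicGeometry.Resolution

/-! ## Arithmetic and window helpers -/

/-- A dimension value in `WithBot ℕ∞` squeezed between `0` and a natural number is a natural
number. [folklore] -/
private theorem exists_nat_eq_of_nonneg_of_le {x : WithBot ℕ∞} {l : ℕ} (h0 : 0 ≤ x) (hl : x ≤ l) :
    ∃ e : ℕ, x = e ∧ e ≤ l := by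
  induction x using WithBot.recBotCoe with
  | bot => exact absurd h0 (by simp)
  | coe a =>
    induction a using ENat.recTopCoe with
    | top =>
      exfalso
      have : ((l : ℕ∞) : WithBot ℕ∞) < ((⊤ : ℕ∞) : WithBot ℕ∞) :=
        WithBot.coe_lt_coe.mpr (ENat.coe_lt_top l)
      exact lt_irrefl _ (lt_of_le_of_lt hl this)
    | coe e =>
      refine ⟨e, rfl, ?_⟩
      have : ((e : ℕ∞) : WithBot ℕ∞) ≤ ((l : ℕ∞) : WithBot ℕ∞) := hl
      exact_mod_cast this

section Anti

variable {B : Type u} [CommRing B] [IsNoetherianRing B] {M : Type u} [AddCommGroup M] [Module B M]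
  [Module.Finite B M]

/-- More factors, smaller product: `extAnn B M T ≤ extAnn B M T'` for `T' ⊆ T`. [folklore] -/
private theorem extAnn_anti {T T' : Finset ℕ} (h : T' ⊆ T) : extAnn B M T ≤ extAnn B M T' := by
  classical
  rw [extAnn, extAnn, ← Finset.prod_sdiff h]
  exact Ideal.mul_le_left

/-- The `Ext`-annihilator ideal for the window `(n - e, max n 2]` lies in the one for the window
`(n - d', max n 2]` whenever `d' ≤ e` (a module of smaller dimension has a larger window start,
hence fewer factors). [folklore] -/
private theorem extAnn_Ioc_mono {n e d' : ℕ} (h : d' ≤ e) :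
    extAnn B M (Finset.Ioc (n - e) (max n 2)) ≤ extAnn B M (Finset.Ioc (n - d') (max n 2)) :=
  extAnn_anti (Finset.Ioc_subset_Ioc (by omega) le_rfl)

end Anti

/-! ## The bridge at the global window, for quotients of the local ring -/

section Bridge

variable {B S O : Type u} [CommRing B] [IsNoetherianRing B]
  [CommRing S] [IsRegularLocalRing S] [Algebra B S] (P : Submonoid B) [IsLocalization P S]
  [CommRing O] [Algebra S O] [Algebra B O] [IsScalarTower B S O]

omit [IsRegularLocalRing S] in
/-- `S ↠ O ↠ O ⧸ J` is surjective. [folklore] -/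
private theorem algebraMap_quotient_surjective (hφ : Function.Surjective (algebraMap S O))
    (J : Ideal O) :
    Function.Surjective (algebraMap S (O ⧸ J)) := by
  intro y
  obtain ⟨x, rfl⟩ := Ideal.Quotient.mk_surjective y
  obtain ⟨s, rfl⟩ := hφ x
  exact ⟨s, rfl⟩

omit [IsRegularLocalRing S] in
/-- `O ⧸ J` is a finite `S`-module along `S ↠ O`. [folklore] -/
private theorem finite_quotient_of_surjective (hφ : Function.Surjective (algebraMap S O))
    (J : Ideal O) :
    Module.Finite S (O ⧸ J) :=
  Module.Finite.of_surjective (Algebra.linearMap S (O ⧸ J)) (algebraMap_quotient_surjective hφ J)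

omit [IsRegularLocalRing S] in
/-- `dim_S Supp (O ⧸ J) = dim (O ⧸ J)` along `S ↠ O`. [folklore] -/
private theorem supportDim_quotient_eq_ringKrullDim_of_surjective
    (hφ : Function.Surjective (algebraMap S O)) (J : Ideal O) :
    Module.supportDim S (O ⧸ J) = ringKrullDim (O ⧸ J) := by
  rw [supportDim_restrictScalars_of_surjective (S := S) (R := O) (M := O ⧸ J) hφ,
    Module.supportDim_quotient_eq_ringKrullDim]

include P in
/-- **The global-to-local bridge for a quotient `O ⧸ J` of the local ring**, at the GLOBAL window:
if `O ⧸ J` (base change `M' = O ⧸ J` of the finite `B`-module `M` to the regular local ring `S` of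
dimension `n`) has dimension `≤ e`, then every `z ∈ extAnn B M (n - e, max n 2]` maps into
`𝔯_S(O ⧸ J)` (window shift `extAnn_Ioc_mono` + `mem_secantColonAnnihilator_of_mem_extAnn`).
[cite: Kawasaki2000, La. 2.5 with La. 5.3] -/
theorem mem_secantColonAnnihilator_quotient_of_mem_extAnn
    (hφ : Function.Surjective (algebraMap S O)) {n e : ℕ} (hn : ringKrullDim S = n)
    {M : Type u} [AddCommGroup M] [Module B M] [Module.Finite B M]
    (J : Ideal O) (hJtop : J ≠ ⊤) (φ : M →ₗ[B] (O ⧸ J)) (hbc : IsBaseChange S φ)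
    (hdim : ringKrullDim (O ⧸ J) ≤ e)
    {z : B} (hz : z ∈ extAnn B M (Finset.Ioc (n - e) (max n 2))) :
    algebraMap B S z ∈ secantColonAnnihilator S (O ⧸ J) := by
  haveI : Nontrivial (O ⧸ J) := Ideal.Quotient.nontrivial_iff.mpr hJtop
  haveI := finite_quotient_of_surjective hφ J
  obtain ⟨d', hd', hd'e⟩ := exists_nat_eq_of_nonneg_of_le
    (ringKrullDim_nonneg_of_nontrivial (R := O ⧸ J)) hdim
  have hsd : Module.supportDim S (O ⧸ J) = d' := by
    rw [supportDim_quotient_eq_ringKrullDim_of_surjective hφ J, hd']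
  exact mem_secantColonAnnihilator_of_mem_extAnn P φ hbc hn hsd (extAnn_Ioc_mono hd'e hz)

end Bridge

/-! ## List bookkeeping: Kawasaki order versus selection order -/

section Lists

variable {α β : Type u}

/-- The `i`-th entry of the selection-order list `[f g_{d-1}, …, f g_t]` is `f g_{d-1-i}`.
[folklore] -/
private theorem getElem_reverse_map_drop_ofFn {d : ℕ} (g : Fin d → α) (f : α → β) (t i : ℕ)
    (hi : i < (((List.ofFn g).drop t).map f).reverse.length) :
    (((List.ofFn g).drop t).map f).reverse[i] =
      f (g ⟨d - 1 - i, by simp only [List.length_reverse, List.length_map, List.length_drop,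
        List.length_ofFn] at hi; omega⟩) := by
  have hi' : i < d - t := by
    simpa only [List.length_reverse, List.length_map, List.length_drop, List.length_ofFn] using hi
  simp only [List.getElem_reverse, List.getElem_map, List.getElem_drop, List.getElem_ofFn,
    List.length_map, List.length_drop, List.length_ofFn]
  congr 2
  ext
  simp only
  omega

/-- The first `i` entries of the selection-order list `[f g_{d-1}, …, f g_t]` generate the same
ideal as `f g_{d-i}, …, f g_{d-1}`. [folklore] -/
private theorem ofList_take_reverse_map_drop_ofFn {R : Type u} [CommRing R] {d : ℕ} (g : Fin d → α)
    (f : α → R) {t i : ℕ} (htd : t ≤ d) (hit : i ≤ d - t) :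
    Ideal.ofList ((((List.ofFn g).drop t).map f).reverse.take i) =
      Ideal.ofList (((List.ofFn g).drop (d - i)).map f) := by
  rw [List.take_reverse, ofList_reverse, ← List.map_drop, List.drop_drop]
  congr 3
  simp only [List.length_map, List.length_drop, List.length_ofFn]
  omega

end Lists

/-! ## The pointwise package (Kawasaki 2000, p. 2539, items 1, 2 and 4) -/

section Core

variable {B S O : Type u} [CommRing B] [IsNoetherianRing B]
  [CommRing S] [IsRegularLocalRing S] [Algebra B S] (P : Submonoid B) [IsLocalization P S]
  [CommRing O] [IsLocalRing O] [IsNoetherianRing O] [Algebra S O] [Algebra B O]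
  [IsScalarTower B S O]

include P in
/-- **Kawasaki's pointwise verification, algebraic core** (Kawasaki 2000, proof of Thm. 5.1,
p. 2539, items 1, 2 and 4, hypotheses-style). Setting: `B` a Noetherian ring (a chart ring of
`ℙⁿ`), `S` a regular local ring of dimension `n` that is a localization of `B` (the local ring of
`ℙⁿ` at the closed point `p`), `O` a Noetherian local ring with `S ↠ O` (the local ring of `X` at
`p`) of dimension `d`; `g_0, …, g_{d-1} ∈ B` (chart representatives of the forms `z_1, …, z_d`, in
Kawasaki's order) and a cut `t < d` such that `g_t, …, g_{d-1}` map into `𝔪_O` and, if `t > 0`,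
`g_{t-1}` maps to a unit of `O`. For each level `l` let `J_l = (g_l, …, g_{d-1}) O` and let the
finite `B`-module `M_l` be a model of `O ⧸ J_l` before localization (`IsBaseChange S (ψ_l)`, `ψ_l :
M_l → O ⧸ J_l`; the chart module of `X ∩ V(z_{l+1}, …, z_d)`). HYPOTHESES: the memberships
`g_l ∈ extAnn B M_{l+1} (n - (l+1), max n 2]` (Kawasaki's `z_i ∈ 𝔞(R/(z_{i+1}, …, z_d)R)`, La. 5.3
(3), in the tree's `Ext`-annihilator form over the chart ring) and the dimension bounds
`dim (O ⧸ J_l) ≤ l` (from La. 5.3 (1)). CONCLUSION: the images `x_t, …, x_{d-1}` of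
`g_t, …, g_{d-1}` in `O` form a `p`-standard sequence of `O` (item 1), and there is `Z ⊆ 𝔪_O`,
weakly regular on `O/(x_t, …, x_{d-1})`, with `x, Z` secant for `O` and `dim O ≤ |x| + |Z|`
(items 2 and 4: `O/(x_t, …, x_{d-1})` is Cohen–Macaulay when `t > 0` by the unit `g_{t-1}`;
`Z = []` when `t = 0`) — literally the hypotheses of `IsBlowup.cmClause_stalk_of_kawasakiCenter`.
[cite: Kawasaki2000, Thm. 5.1 (proof, p. 2539, items 1–4)] -/
theorem kawasaki_pointwise_package
    (hφ : Function.Surjective (algebraMap S O)) {n d : ℕ} (hn : ringKrullDim S = n)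
    (hdim : ringKrullDim O = d) (g : Fin d → B) {t : ℕ} (htd : t < d)
    (hmem : ∀ l : Fin d, t ≤ (l : ℕ) → algebraMap B O (g l) ∈ maximalIdeal O)
    (hunit : ∀ h0 : 0 < t, IsUnit (algebraMap B O (g ⟨t - 1, by omega⟩)))
    (J : ℕ → Ideal O)
    (hJ : ∀ l, t ≤ l → l ≤ d → J l = Ideal.ofList (((List.ofFn g).drop l).map (algebraMap B O)))
    (hdimJ : ∀ l, t ≤ l → l < d → ringKrullDim (O ⧸ J l) ≤ l)
    (M : ℕ → Type u) [∀ l, AddCommGroup (M l)] [∀ l, Module B (M l)]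
    [∀ l, Module.Finite B (M l)]
    (ψ : ∀ l, M l →ₗ[B] (O ⧸ J l)) (hψ : ∀ l, t ≤ l → l ≤ d → IsBaseChange S (ψ l))
    (hann : ∀ l : Fin d, t ≤ (l : ℕ) + 1 →
      g l ∈ extAnn B (M (l + 1)) (Finset.Ioc (n - (l + 1)) (max n 2))) :
    ∃ xs Z : List O, xs = ((List.ofFn g).drop t).map (algebraMap B O) ∧
      IsPStandard O xs ∧ (∀ z ∈ Z, z ∈ maximalIdeal O) ∧
      IsWeaklyRegular (O ⧸ Ideal.ofList xs) Z ∧ IsSecantSequence O (xs ++ Z) ∧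
      ringKrullDim O ≤ xs.length + Z.length ∧ 0 < xs.length := by
  classical
  -- the Kawasaki-order images `xs = [x_t, …, x_{d-1}]`
  set xs : List O := ((List.ofFn g).drop t).map (algebraMap B O) with hxs_def
  have hxslen : xs.length = d - t := by
    simp only [hxs_def, List.length_map, List.length_drop, List.length_ofFn]
  have htower : ∀ b : B, algebraMap S O (algebraMap B S b) = algebraMap B O b :=
    fun b => (IsScalarTower.algebraMap_apply B S O b).symm
  have hcomp : (algebraMap S O : S → O) ∘ (algebraMap B S : B → S) = algebraMap B O :=
    funext htower
  -- entries of `(ofFn g).drop l` are `g l'` with `l ≤ l'`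
  have hmem_drop : ∀ (l : ℕ) (b : B), b ∈ (List.ofFn g).drop l →
      ∃ l' : Fin d, l ≤ l' ∧ b = g l' := by
    intro l b hb
    obtain ⟨i, hi, rfl⟩ := List.mem_iff_getElem.mp hb
    refine ⟨⟨l + i, ?_⟩, ?_, ?_⟩
    · simp only [List.length_drop, List.length_ofFn] at hi; omega
    · simp
    · simp only [List.getElem_drop, List.getElem_ofFn]
  have hJmem : ∀ l, t ≤ l → l ≤ d → ∀ x ∈ ((List.ofFn g).drop l).map (algebraMap B O),
      x ∈ maximalIdeal O := by
    intro l htl _ x hx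
    obtain ⟨b, hb, rfl⟩ := List.mem_map.mp hx
    obtain ⟨l', hl', rfl⟩ := hmem_drop l b hb
    exact hmem l' (htl.trans hl')
  have hxsmem : ∀ x ∈ xs, x ∈ maximalIdeal O := hJmem t le_rfl htd.le
  -- `J_l ≠ ⊤`
  have hJtop : ∀ l, t ≤ l → l ≤ d → J l ≠ ⊤ := by
    intro l htl hld htop
    rw [hJ l htl hld] at htop
    have hle : Ideal.ofList (((List.ofFn g).drop l).map (algebraMap B O)) ≤ maximalIdeal O :=
      Ideal.span_le.mpr fun x hx => hJmem l htl hld x hx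
    exact (maximalIdeal.isMaximal O).ne_top (top_le_iff.mp (htop ▸ hle))
  -- the dimension bound at the top level `l = d`: `J_d = 0`, `dim O = d`
  have hdimJ' : ∀ l, t ≤ l → l ≤ d → ringKrullDim (O ⧸ J l) ≤ l := by
    intro l htl hld
    rcases lt_or_eq_of_le hld with h | h
    · exact hdimJ l htl h
    · subst h
      have hbot : J l = ⊥ := by
        rw [hJ l htl le_rfl, List.drop_of_length_le (by simp), List.map_nil, Ideal.ofList_nil]
      rw [ringKrullDim_eq_of_ringEquiv ((Ideal.quotEquivOfEq hbot).trans
        (RingEquiv.quotientBot O)), hdim]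
  -- the bridge at each level: `g_l / 1 ∈ 𝔯_S(O ⧸ J_{l+1})`
  have hbridge : ∀ (l : Fin d) (m : ℕ), m = (l : ℕ) + 1 → t ≤ m →
      algebraMap B S (g l) ∈ secantColonAnnihilator S (O ⧸ J m) := fun l m hm hl => by
    subst hm
    exact mem_secantColonAnnihilator_quotient_of_mem_extAnn P hφ hn (J (l + 1)) (hJtop _ hl l.2)
      (ψ (l + 1)) (hψ _ hl l.2) (hdimJ' _ hl l.2) (hann l hl)
  -- `dim O/(x_t, …, x_{d-1}) = t`: `≤ t` is the hypothesis, `≥ t` is Krull's bound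
  have hJt : J t = Ideal.ofList xs := hJ t le_rfl htd.le
  have he : ringKrullDim (O ⧸ Ideal.ofList xs) = t := by
    have hle : ringKrullDim (O ⧸ Ideal.ofList xs) ≤ t := by rw [← hJt]; exact hdimJ t le_rfl htd
    have hne : Ideal.ofList xs ≠ ⊤ := by rw [← hJt]; exact hJtop t le_rfl htd.le
    haveI : Nontrivial (O ⧸ Ideal.ofList xs) := Ideal.Quotient.nontrivial_iff.mpr hne
    obtain ⟨e, he, het⟩ := exists_nat_eq_of_nonneg_of_le
      (ringKrullDim_nonneg_of_nontrivial (R := O ⧸ Ideal.ofList xs)) hle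
    have hkrull := supportDim_le_supportDim_quotient_add_length (R := O) (M := O) xs hxsmem
    rw [supportDim_self_eq_ringKrullDim, supportDim_quotient_ofList_smul_top, hdim, he,
      hxslen] at hkrull
    have : d ≤ e + (d - t) := by
      have h' : ((d : ℕ∞) : WithBot ℕ∞) ≤ ((e + (d - t) : ℕ) : ℕ∞) := by
        push_cast at hkrull ⊢; exact hkrull
      exact_mod_cast h'
    have heq : e = t := by omega
    rw [he, heq]
  -- ITEM 1: the selection-order list `rs = [g_{d-1}, …, g_t]` in `S`
  set rs : List S := (((List.ofFn g).drop t).map (algebraMap B S)).reverse with hrs_def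
  have hrslen : rs.length = d - t := by
    simp only [hrs_def, List.length_reverse, List.length_map, List.length_drop, List.length_ofFn]
  have hrsO : rs.map (algebraMap S O) = xs.reverse := by
    rw [hrs_def, List.map_reverse, List.map_map, hcomp]
  have hmemS : ∀ r ∈ rs, r ∈ maximalIdeal S := by
    intro r hr
    rw [hrs_def, List.mem_reverse] at hr
    obtain ⟨b, hb, rfl⟩ := List.mem_map.mp hr
    obtain ⟨l', hl', rfl⟩ := hmem_drop t b hb
    rw [← mem_maximalIdeal_iff_of_surjective hφ, htower]
    exact hmem l' hl'
  have hannS : ∀ (i : ℕ) (hi : i < rs.length),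
      rs[i] ∈ secantColonAnnihilator S (O ⧸ (ofList (rs.take i) • ⊤ : Submodule S O)) := by
    intro i hi
    have hid : i < d - t := by rw [← hrslen]; exact hi
    -- `rs[i] = g_l / 1` with `l = d - 1 - i`
    have hri : rs[i] = algebraMap B S (g ⟨d - 1 - i, by omega⟩) :=
      getElem_reverse_map_drop_ofFn g (algebraMap B S) t i hi
    -- `(rs.take i) = (g_{l+1}, …, g_{d-1})` as ideals of `S`
    set ys : List S := ((List.ofFn g).drop (d - i)).map (algebraMap B S) with hys_def
    have htake : (ofList (rs.take i) : Ideal S) = ofList ys :=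
      ofList_take_reverse_map_drop_ofFn g (algebraMap B S) htd.le hid.le
    have hysO : ys.map (algebraMap S O) = ((List.ofFn g).drop (d - i)).map (algebraMap B O) := by
      rw [hys_def, List.map_map, hcomp]
    -- `O ⧸ (ys) O ≃ₗ[S] O ⧸ J_{d-i}`
    have hJdi : (ofList (ys.map (algebraMap S O)) • ⊤ : Submodule O O) =
        (J (d - i)).restrictScalars O := by
      rw [ofList_smul_top_eq, hysO, ← hJ (d - i) (by omega) (by omega)]
      rfl
    have e : (O ⧸ (ofList ys • ⊤ : Submodule S O)) ≃ₗ[S] (O ⧸ J (d - i)) :=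
      (quotOfListMapEquiv (M := O) hφ ys).trans
        ((Submodule.quotEquivOfEq _ _ hJdi).restrictScalars S)
    rw [secantColonAnnihilator_quotient_congr (congrArg (· • (⊤ : Submodule S O)) htake),
      secantColonAnnihilator_congr e, hri]
    exact hbridge ⟨d - 1 - i, by omega⟩ (d - i) (by simp only; omega) (by omega)
  have he' : ringKrullDim (O ⧸ (ofList (rs.map (algebraMap S O)) : Ideal O)) = t := by
    rw [hrsO, ofList_reverse]; exact he
  have hlen : t + rs.length = d := by rw [hrslen]; omega
  have hP : IsPStandard O xs := by
    have h1 := isPStandard_reverse_map_of_mem_secantColonAnnihilator hφ hmemS hannS hdim he' hlen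
    rwa [hrsO, List.reverse_reverse] at h1
  have hxspos : 0 < xs.length := by rw [hxslen]; omega
  -- ITEMS 2 AND 4: the tail `Z`
  rcases Nat.eq_zero_or_pos t with ht0 | ht0
  · -- `t = 0`: all of `z_1, …, z_d` vanish at `p`; no tail
    refine ⟨xs, [], rfl, hP, fun _ h => by simp at h, IsWeaklyRegular.nil _ _, ?_, ?_, hxspos⟩
    · rw [List.append_nil]; exact hP.isSecantSequence
    · rw [hdim, hxslen, ht0, List.length_nil, Nat.cast_zero, add_zero, Nat.sub_zero]
  · -- `t > 0`: the unit `g_{t-1}` lies in `𝔯_S(O ⧸ (x_t, …, x_{d-1}))`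
    have hu : IsUnit (algebraMap S O (algebraMap B S (g ⟨t - 1, by omega⟩))) := by
      rw [htower]; exact hunit ht0
    have huann : algebraMap B S (g ⟨t - 1, by omega⟩) ∈
        secantColonAnnihilator S (O ⧸ (Ideal.ofList xs : Ideal O)) := by
      have hb := hbridge ⟨t - 1, by omega⟩ t (by simp only; omega) le_rfl
      rwa [hJt] at hb
    have hlen' : t + xs.length = d := by rw [hxslen]; omega
    obtain ⟨Z, hZmem, hZreg, hZsec, hZlen⟩ :=
      exists_regular_sop_of_unit_mem_secantColonAnnihilator hφ xs hxsmem hu huann hdim he hlen'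
    refine ⟨xs, Z, rfl, hP, hZmem, hZreg, hZsec, ?_, hxspos⟩
    rw [hdim, hxslen, hZlen]
    exact_mod_cast (by omega : d ≤ d - t + t)

include P in
/-- **Kawasaki's pointwise verification, item 3: off `V(z_d)` the local ring is Cohen–Macaulay**
(Kawasaki 2000, p. 2539: "If `𝔟 ⊄ 𝔭` then `∏ ann Hʲ(D) ⊄ 𝔭`. Hence `𝒪_{Y,q} = R_(𝔭)` is
Cohen–Macaulay"). Hypotheses-style, in the setting of `kawasaki_pointwise_package`: if the chart
representative `z ∈ B` of the last form lies in `extAnn B M (n - d, max n 2]` for a finite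
`B`-module `M` whose base change to `S` is `O` itself (`ψ : M → O ⧸ J`, `J = 0`), and `z` maps
to a unit of `O`, then every system of parameters of `O` is a weakly regular sequence
(`cmClause_of_unit_mem_secantColonAnnihilator` after the bridge).
[cite: Kawasaki2000, Thm. 5.1 (proof, p. 2539, item 3)] -/
theorem cmClause_of_mem_extAnn_of_isUnit
    (hφ : Function.Surjective (algebraMap S O)) {n d : ℕ} (hn : ringKrullDim S = n)
    (hdim : ringKrullDim O = d) {M : Type u} [AddCommGroup M] [Module B M] [Module.Finite B M]
    (J : Ideal O) (hJ : J = ⊥) (ψ : M →ₗ[B] (O ⧸ J)) (hψ : IsBaseChange S ψ)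
    {z : B} (hz : z ∈ extAnn B M (Finset.Ioc (n - d) (max n 2)))
    (hu : IsUnit (algebraMap B O z)) :
    ∀ e : ℕ, ringKrullDim O = e → ∀ s : Fin e → O, (Ideal.span (Set.range s)).radical.IsMaximal →
      IsWeaklyRegular O (List.ofFn s) := by
  have hJtop : J ≠ ⊤ := by rw [hJ]; exact bot_ne_top
  have hdimJ : ringKrullDim (O ⧸ J) ≤ d := by
    rw [ringKrullDim_eq_of_ringEquiv ((Ideal.quotEquivOfEq hJ).trans (RingEquiv.quotientBot O)),
      hdim]
  have hb := mem_secantColonAnnihilator_quotient_of_mem_extAnn P hφ hn J hJtop ψ hψ hdimJ hz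
  have e : (O ⧸ J) ≃ₗ[S] O := (Submodule.quotEquivOfEqBot (J : Submodule O O) hJ).restrictScalars S
  rw [secantColonAnnihilator_congr e] at hb
  have hu' : IsUnit (algebraMap S O (algebraMap B S z)) := by
    rw [← IsScalarTower.algebraMap_apply]; exact hu
  exact cmClause_of_unit_mem_secantColonAnnihilator hφ hu' hb

end Core

/-! ## The centre at a point where only the last prefix entry is a unit

(Slot-test snippet of res-type-079, 2026-08-27, folded in verbatim: Kawasaki's
`t := min {i : z_i, …, z_d ∈ 𝔪_p}` makes only `z_{t-1}` a unit at `p`, so the reduction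
`𝔟(z_1..z_d) 𝒪_p = 𝔟(z_t..z_d) 𝒪_p` needs the sharp form of `kawasakiCenter_append_of_isUnit`.) -/

section CentreUnitLast

variable {R : Type u} [CommRing R]

/-- **Local form of the centre, sharp version**: if the LAST entry of the non-empty prefix `as` is
a unit then `𝔟(as ++ bs) = 𝔟(bs)` — every factor `ofList ((as ++ bs).drop i)` with `i < |as|`
contains `as.getLast`. (Kawasaki: `𝔟 𝒪_p = ∏_{i ≥ t} (z_i, …, z_d) 𝒪_p` with
`t = min {i : z_i, …, z_d ∈ 𝔪_p}`, where only `z_{t-1}` is known to be a unit.)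
[cite: Kawasaki2000, Thm. 5.1 (proof, p. 2539)] -/
theorem kawasakiCenter_append_of_isUnit_getLast (as bs : List R) (hne : as ≠ [])
    (h : IsUnit (as.getLast hne)) : kawasakiCenter (as ++ bs) = kawasakiCenter bs := by
  induction as with
  | nil => exact absurd rfl hne
  | cons a as ih =>
    rw [List.cons_append, kawasakiCenter_cons]
    have hmem : (a :: as).getLast hne ∈ a :: (as ++ bs) := by
      have := List.getLast_mem hne
      rw [← List.cons_append]
      exact List.mem_append_left _ this
    rw [ofList_eq_top_of_isUnit_mem hmem h, Ideal.top_mul]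
    by_cases has : as = []
    · subst has; rfl
    · have hlast : (a :: as).getLast hne = as.getLast has := List.getLast_cons has
      exact ih has (hlast ▸ h)

/-- The same under a ring map `f` (e.g. to the local ring at a point): if `f` sends the last entry
of the non-empty prefix `as` to a unit then `𝔟(as ++ bs) S = 𝔟(f bs)`.
[cite: Kawasaki2000, Thm. 5.1 (proof, p. 2539)] -/
theorem map_kawasakiCenter_append_of_isUnit_getLast {S : Type u} [CommRing S] (f : R →+* S)
    (as bs : List R) (hne : as ≠ []) (h : IsUnit (f (as.getLast hne))) :
    (kawasakiCenter (as ++ bs)).map f = kawasakiCenter (bs.map f) := by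
  rw [kawasakiCenter_map, List.map_append]
  refine kawasakiCenter_append_of_isUnit_getLast _ _ (by simpa using hne) ?_
  rwa [List.getLast_map]

/-- `List.ofFn` form, as delivered by `stalkIdeal_kawasakiCentreSheaf` (germs `g l` of the chart
values of `z : Fin d → forms`): `𝔟(ofFn g) = 𝔟((ofFn g).drop s)` whenever `0 < s ≤ d` and
`g ⟨s-1, _⟩` is a unit. [cite: Kawasaki2000, Thm. 5.1 (proof, p. 2539)] -/
theorem kawasakiCenter_ofFn_eq_drop_of_isUnit {d : ℕ} (g : Fin d → R) {s : ℕ} (hs : 0 < s)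
    (hsd : s ≤ d) (h : IsUnit (g ⟨s - 1, by omega⟩)) :
    kawasakiCenter (List.ofFn g) = kawasakiCenter ((List.ofFn g).drop s) := by
  conv_lhs => rw [← List.take_append_drop s (List.ofFn g)]
  have hne : (List.ofFn g).take s ≠ [] := by
    simp [List.take_eq_nil_iff]; omega
  refine kawasakiCenter_append_of_isUnit_getLast _ _ hne ?_
  have : ((List.ofFn g).take s).getLast hne = g ⟨s - 1, by omega⟩ := by
    rw [List.getLast_eq_getElem]
    simp [List.getElem_take, List.length_take, List.length_ofFn, Nat.min_eq_left hsd]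
  rwa [this]

end CentreUnitLast

/-! ## The scheme statement: the stalks of the blowing up along Kawasaki's centre -/

section Scheme

open CategoryTheory _root_.AlgebraicGeometry TopologicalSpace
open Literature.AlgebraicGeometry.Motives Literature.AlgebraicGeometry.Motives.GeneratingSections

variable {k : Type u} [Field k] {n : ℕ} {Y : SchemeOver k} (r : Y ⟶ projectiveSpace n k)
  {d : ℕ} (z : Fin d → MvPolynomial (Fin (n + 1)) k) (N : Fin d → ℕ)
  (hz : ∀ l, (z l).IsHomogeneous (N l))
  [IsAffineHom r.left] [QuasiSeparatedSpace Y.left] [IsIntegral Y.left] [IsLocallyNoetherian Y.left]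

/-- **Kawasaki's pointwise verification at a point of the blowing up** (Kawasaki 2000, proof of
Thm. 5.1, p. 2539: "Assume that `𝔟 ⊆ 𝔭`. Then `z_t, …, z_d ∈ 𝔭` and `z_{t-1} ∉ 𝔭` for some
`1 ≤ t ≤ s + 1` … Hence `x_t, …, x_d` is a subsystem of a p-standard system of parameters for
`R_(𝔭)` and `R_(𝔭)/(x_t, …, x_d)R_(𝔭)` is a Cohen–Macaulay ring if `t > 1`. Since
`𝔟R_(𝔭) = ∏_{i=t}^{s+1} (x_i, …, x_d)R_(𝔭)`, Corollary 4.2 says that `𝒪_{Y,q}` is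
Cohen–Macaulay."). Let `r : Y → ℙⁿ_k` be affine with `Y` integral and locally Noetherian,
`z_0, …, z_{d-1}` forms, `π : X' → Y` a blowing up along Kawasaki's centre
`kawasakiCentreSheaf r z N hz = ∏_l (z_l, …, z_{d-1})𝒪_Y`, and `x' ∈ X'` a point over
`p = π x' ∈ r⁻¹D₊(x_j)`. HYPOTHESES (entered by name, so that the chart dictionary of
`KawasakiCharts.lean` and the selection of the forms plug in by `exact`): the algebraic data of
`kawasaki_pointwise_package` at the local ring `O = 𝒪_{Y,p}` — a regular local `S` of dimension
`n`, localization of a Noetherian `B`, with `S ↠ 𝒪_{Y,p}`; chart representatives `g_l ∈ B` whose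
images in `𝒪_{Y,p}` are the germs of the chart values `z_l / x_j^{N_l}`; the cut `t` (`g_t, …`
vanish at `p`, `g_{t-1}` does not); models `M_l` of `𝒪_{Y,p} ⧸ (g_l, …, g_{d-1})` over `B` with
the memberships `g_l ∈ extAnn B M_{l+1} (n - (l+1), max n 2]` and the bounds
`dim 𝒪_{Y,p}/(g_l, …) ≤ l`, `dim 𝒪_{Y,p} = d`. CONCLUSION: every system of parameters of
`𝒪_{X',x'}` is a weakly regular sequence. Proof: `kawasaki_pointwise_package`, the stalk of the
centre `stalkIdeal_kawasakiCentreSheaf` reduced by `kawasakiCenter_ofFn_eq_drop_of_isUnit`, and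
`IsBlowup.cmClause_stalk_of_kawasakiCenter` (Kawasaki's Cor. 4.2).
[cite: Kawasaki2000, Thm. 5.1 (proof, p. 2539)] -/
theorem IsBlowup.cmClause_stalk_of_kawasakiCentreSheaf
    {X' : Scheme.{u}} {π : X' ⟶ Y.left} (hπ : IsBlowup π (kawasakiCentreSheaf r z N hz))
    (x' : X') (j : Fin (n + 1)) (hp : π x' ∈ (GeneratingSections.ofHom r.left).U j)
    {B S : Type u} [CommRing B] [IsNoetherianRing B] [CommRing S] [IsRegularLocalRing S]
    [Algebra B S] (P : Submonoid B) [IsLocalization P S]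
    [Algebra S (Y.left.presheaf.stalk (π x'))] [Algebra B (Y.left.presheaf.stalk (π x'))]
    [IsScalarTower B S (Y.left.presheaf.stalk (π x'))]
    (hφ : Function.Surjective (algebraMap S (Y.left.presheaf.stalk (π x'))))
    (hn : ringKrullDim S = n) (hdim : ringKrullDim (Y.left.presheaf.stalk (π x')) = d)
    (g : Fin d → B)
    (hg : ∀ l, algebraMap B (Y.left.presheaf.stalk (π x')) (g l) =
      (Y.left.presheaf.germ ((GeneratingSections.ofHom r.left).U j) (π x') hp).hom
        (chartVal r z N hz l j))
    {t : ℕ} (htd : t < d)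
    (hmem : ∀ l : Fin d, t ≤ (l : ℕ) →
      algebraMap B (Y.left.presheaf.stalk (π x')) (g l) ∈
        maximalIdeal (Y.left.presheaf.stalk (π x')))
    (hunit : ∀ h0 : 0 < t,
      IsUnit (algebraMap B (Y.left.presheaf.stalk (π x')) (g ⟨t - 1, by omega⟩)))
    (J : ℕ → Ideal (Y.left.presheaf.stalk (π x')))
    (hJ : ∀ l, t ≤ l → l ≤ d → J l = Ideal.ofList (((List.ofFn g).drop l).map
      (algebraMap B (Y.left.presheaf.stalk (π x')))))
    (hdimJ : ∀ l, t ≤ l → l < d → ringKrullDim (Y.left.presheaf.stalk (π x') ⧸ J l) ≤ l)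
    (M : ℕ → Type u) [∀ l, AddCommGroup (M l)] [∀ l, Module B (M l)]
    [∀ l, Module.Finite B (M l)]
    (ψ : ∀ l, M l →ₗ[B] (Y.left.presheaf.stalk (π x') ⧸ J l))
    (hψ : ∀ l, t ≤ l → l ≤ d → IsBaseChange S (ψ l))
    (hann : ∀ l : Fin d, t ≤ (l : ℕ) + 1 →
      g l ∈ extAnn B (M (l + 1)) (Finset.Ioc (n - (l + 1)) (max n 2))) :
    ∀ e : ℕ, ringKrullDim (X'.presheaf.stalk x') = e → ∀ s : Fin e → X'.presheaf.stalk x',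
      (Ideal.span (Set.range s)).radical.IsMaximal →
        IsWeaklyRegular (X'.presheaf.stalk x') (List.ofFn s) := by
  obtain ⟨xs, Z, hxs, hP, hZmem, hZreg, hZsec, hdimle, hpos⟩ :=
    kawasaki_pointwise_package P hφ hn hdim g htd hmem hunit J hJ hdimJ M ψ hψ hann
  refine hπ.cmClause_stalk_of_kawasakiCenter x' hP hZsec hZmem hZreg hdimle hpos ?_
  -- the centre at `p`: `𝔟 𝒪_p = 𝔟(x_t, …, x_{d-1})`
  rw [stalkIdeal_kawasakiCentreSheaf r z N hz j hp]
  have hγ : (List.ofFn fun l => (Y.left.presheaf.germ ((GeneratingSections.ofHom r.left).U j)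
      (π x') hp).hom (chartVal r z N hz l j)) =
        List.ofFn (fun l => algebraMap B (Y.left.presheaf.stalk (π x')) (g l)) :=
    congrArg List.ofFn (funext fun l => (hg l).symm)
  have hxs' : xs =
      (List.ofFn fun l => algebraMap B (Y.left.presheaf.stalk (π x')) (g l)).drop t := by
    rw [hxs, List.map_drop, List.map_ofFn]; rfl
  rw [hγ, hxs']
  rcases Nat.eq_zero_or_pos t with ht0 | ht0
  · rw [ht0, List.drop_zero]
  · exact kawasakiCenter_ofFn_eq_drop_of_isUnit _ ht0 htd.le (hunit ht0)

end Scheme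

end Literature.AlgebraicGeometry.Resolution

end
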